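import Literature.Computability.Complexity.DescriptionLengthSpace
import HarnessLib

/-!
# The OR language in work space `1` by a bounded-hardware machine of description length `7`

A second concrete space machine in the style of `TrivialLanguagesSpace.lean` (`ConstAnswer`), this
time one that READS its input: the **OR machine** `OrAnswer.machine` (three Boolean stacks `inp`,
`out`, `left` — the stacks `ConstAnswer.K3` are reused — internal memory `Bool × Option Bool`, one
label carrying the single statement
`pop inp; if some a was read then (push left a; flag := flag || a; loop) else (push out flag; halt)`).
It decides the OR language `orLang = {x | true ∈ x}` in work space `1`, reading the input once from
left to right through the read-only discipline `reverse left ++ inp = x`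
(`OrAnswer.decidesInSpace`); it has bounded hardware (`OrAnswer.hasBoundedHardware`: 3 stacks,
alphabets of size 2, 6 memory values) and rendered description length `descLen = 7`
(`OrAnswer.descLen_eq`: seven statement nodes, one label).  Consequently
(`orLang_slice_mem_DSPACEdl`) the length-`n` slice of `orLang` — the `n`-bit OR, a function that
depends on every variable (`boolIndicator_orLang_ofFn`) — lies in the rendered class
`DSPACEdl t a n` of census D13 for every `t ≥ 1`, `a ≥ 7`: the class `DSPACE(cn)/ₙ cn` of
Hirahara's Thm. 1.13 (second rendering) contains, at every length `n ≥ 7`, a function outside every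
junta class — used in `MetaComplexity/Hirahara2020/DlYesNotSmallBPYes.lean` to separate the two
tree renderings of row R28 of the magnification census (census gap note G35 explains why the
converse inclusion would need an interpreter-style machine).  Proofs only, plus the machine; nothing
here bears on a summit.

## References

* S. Arora, B. Barak, *Computational Complexity: A Modern Approach*, CUP 2009, Def. 4.1 (space-
  bounded computation with a read-only input tape) [AroraBarak2009].
* S. Hirahara, *Non-disjoint promise problems from meta-computational view of pseudorandom
  generator constructions*, Theory of Computing 19(4), 2023, Def. 4.7 (p. 33: `DSPACE(s)/ₙ a`)
  [Hirahara2023NonDisjoint].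
-/

noncomputable section

namespace Literature.Computability.Complexity

open _root_.Computability Turing StateTransition Function

/-- **The OR language**: binary strings containing a `true`. [folklore] -/
def orLang : Language Bool := {x | true ∈ x}

/-- Its indicator is `List.any`. [folklore] -/
theorem boolIndicator_orLang (x : List Bool) : orLang.boolIndicator x = x.any id := by
  unfold Set.boolIndicator orLang
  simp only [Set.mem_setOf_eq]
  by_cases h : true ∈ x
  · rw [if_pos h]
    exact (List.any_eq_true.2 ⟨true, h, rfl⟩).symm
  · rw [if_neg h]
    symm
    rw [Bool.eq_false_iff]
    intro h'
    obtain ⟨a, ha, haid⟩ := List.any_eq_true.1 h'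
    exact h (by simpa [show a = true from haid] using ha)

/-- The length-`n` slice of the OR language is the `n`-bit OR. [folklore] -/
theorem boolIndicator_orLang_ofFn {n : ℕ} (v : Fin n → Bool) :
    orLang.boolIndicator (List.ofFn v) = decide (∃ i, v i = true) := by
  rw [boolIndicator_orLang]
  apply Bool.eq_iff_iff.2
  simp [List.any_eq_true, List.mem_ofFn]

/-! ### The OR machine -/

namespace OrAnswer

open ConstAnswer (K3 stk stk_inp stk_out stk_left update_stk_out)

/-- The program: at the unique label, `pop inp` into the memory's second component; if a symbol
`a` was read, `push left a`, set the flag to `flag || a`, clear the second component and loop;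
otherwise `push out flag` and halt. [folklore] -/
def prog : Unit → TM2.Stmt (fun _ : K3 => Bool) Unit (Bool × Option Bool) :=
  fun _ => TM2.Stmt.pop K3.inp (fun s a => (s.1, a))
    (TM2.Stmt.branch (fun s => s.2.isSome)
      (TM2.Stmt.push K3.left (fun s => s.2.getD false)
        (TM2.Stmt.load (fun s => (s.1 || s.2.getD false, none))
          (TM2.Stmt.goto fun _ => ())))
      (TM2.Stmt.push K3.out (fun s => s.1) TM2.Stmt.halt))

/-- The OR machine (canonical instances, as in `TrivialLanguagesSpace.lean`). [folklore] -/
def tm : FinTM2 where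
  K := K3
  kDecidableEq := inferInstance
  kFin := inferInstance
  k₀ := K3.inp
  k₁ := K3.out
  Γ := fun _ => Bool
  Λ := Unit
  main := ()
  ΛFin := inferInstance
  σ := Bool × Option Bool
  initialState := (false, none)
  σFin := inferInstance
  Γk₀Fin := inferInstanceAs (Fintype Bool)
  m := prog

/-- The OR machine as a space machine (read-only input on `left`/`inp`; all alphabet
identifications the identity). [folklore] -/
def machine : SpaceMachine Bool Bool where
  tm := tm
  inputAlphabet := Equiv.refl Bool
  outputAlphabet := Equiv.refl Bool
  kL := K3.left
  kL_ne_k₀ := fun h => K3.noConfusion h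
  kL_ne_k₁ := fun h => K3.noConfusion h
  leftAlphabet := Equiv.refl Bool

/-- Updating the input stack. [folklore] -/
@[simp] theorem update_stk_inp (i o l i' : List Bool) :
    Function.update (stk i o l) K3.inp i' = stk i' o l := by funext k; cases k <;> rfl
/-- Updating the left input stack. [folklore] -/
@[simp] theorem update_stk_left (i o l l' : List Bool) :
    Function.update (stk i o l) K3.left l' = stk i o l' := by funext k; cases k <;> rfl

/-- Configurations with a cleared second memory component. [folklore] -/
def cfg (lab : Option Unit) (fl : Bool) (i o l : List Bool) : tm.Cfg := ⟨lab, (fl, none), stk i o l⟩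

/-- The step function with canonical instances. [folklore] -/
theorem tm_step (c : tm.Cfg) : tm.step c = TM2.step prog c := rfl

/-- One loop iteration: read `a`, move it to the left stack, update the flag. [folklore] -/
theorem step_cons (fl a : Bool) (i o l : List Bool) :
    tm.step (cfg (some ()) fl (a :: i) o l) = some (cfg (some ()) (fl || a) i o (a :: l)) := by
  rw [tm_step]; simp [cfg, TM2.step, prog, TM2.stepAux]; rfl

/-- Input exhausted: write the flag and halt. [folklore] -/
theorem step_nil (fl : Bool) (o l : List Bool) :
    tm.step (cfg (some ()) fl [] o l) = some (cfg none fl [] (fl :: o) l) := by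
  rw [tm_step]; simp [cfg, TM2.step, prog, TM2.stepAux]; rfl

/-- The machine does not move once halted. [folklore] -/
theorem step_halt (fl : Bool) (i o l : List Bool) : tm.step (cfg none fl i o l) = none := rfl

/-- The initial configuration. [folklore] -/
theorem init_eq (x : List Bool) : machine.init x = cfg (some ()) false x [] [] := by
  refine TM2.Cfg.mk.injEq _ _ _ _ _ _ |>.mpr ⟨rfl, rfl, ?_⟩
  funext k; cases k
  · exact (SpaceMachine.init_stk_k₀ machine x).trans (List.map_id x)
  · exact SpaceMachine.init_stk_of_ne machine x (k := K3.out) (fun h => K3.noConfusion h)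
  · exact SpaceMachine.init_stk_of_ne machine x (k := K3.left) (fun h => K3.noConfusion h)

/-- The work space of a configuration is the length of the output stack. [folklore] -/
theorem workSpace_cfg (lab : Option Unit) (fl : Bool) (i o l : List Bool) :
    machine.workSpace (cfg lab fl i o l) = o.length := by
  change ∑ k ∈ ((Finset.univ : Finset K3).erase K3.inp).erase K3.left, (stk i o l k).length = _
  rw [show ((Finset.univ : Finset K3).erase K3.inp).erase K3.left = {K3.out} by decide,
    Finset.sum_singleton, stk_out]

/-- A configuration spells `reverse left ++ inp`. [folklore] -/
theorem inputOf_cfg (lab : Option Unit) (fl : Bool) (i o l : List Bool) :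
    machine.inputOf (cfg lab fl i o l) = l.reverse ++ i := by
  change (List.map id l).reverse ++ List.map id i = _
  rw [List.map_id, List.map_id]

/-- **The run.** From the loop label with flag `fl`, unread input `i`, read input `l` (reversed on
the left stack) and empty output, the machine runs — through configurations all spelling
`l.reverse ++ i` and using work space `≤ 1` — to the halted configuration with the whole input on
the left stack and output `[fl || i.any id]`. [folklore] -/
theorem run (x : List Bool) : ∀ (i l : List Bool) (fl : Bool), l.reverse ++ i = x →
    SpaceLoop.RunsVia tm.step (fun c => machine.inputOf c = x ∧ machine.workSpace c ≤ 1)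
      (cfg (some ()) fl i [] l)
      (cfg none (fl || i.any id) [] [fl || i.any id] (i.reverse ++ l))
  | [], l, fl, h => by
    have h' : l.reverse = x := by simpa using h
    simpa using SpaceLoop.RunsVia.single (step_nil fl [] l)
      ⟨by rw [inputOf_cfg]; simpa using h', by rw [workSpace_cfg]; simp⟩
      ⟨by rw [inputOf_cfg]; simpa using h', by rw [workSpace_cfg]; simp⟩
  | a :: i, l, fl, h => by
    have h' : (a :: l).reverse ++ i = x := by simpa using h
    have ih := run x i (a :: l) (fl || a) h'
    have e : i.reverse ++ a :: l = (a :: i).reverse ++ l := by simp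
    rw [Bool.or_assoc, e] at ih
    exact SpaceLoop.RunsVia.step_trans (step_cons fl a i [] l)
      ⟨by rw [inputOf_cfg]; exact h, by rw [workSpace_cfg]; simp⟩ (by simpa using ih)

/-- **The OR machine decides the OR language in work space `1`.** [folklore] -/
theorem decidesInSpace : DecidesInSpace machine orLang (fun _ => 1) := by
  have run' : ∀ x : List Bool, SpaceLoop.RunsVia tm.step
      (fun c => machine.inputOf c = x ∧ machine.workSpace c ≤ 1)
      (machine.init x) (cfg none (x.any id) [] [x.any id] x.reverse) := by
    intro x
    rw [init_eq]
    simpa using run x x [] false (by simp)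
  refine ⟨fun x c hc => ((run' x).forall_reaches (step_halt _ [] _ _) c hc).1,
    fun x => ⟨⟨cfg none (x.any id) [] [x.any id] x.reverse,
      (run' x).mem_eval (step_halt _ [] _ _), ?_⟩,
      fun c hc => ((run' x).forall_reaches (step_halt _ [] _ _) c hc).2⟩⟩
  change [x.any id] = encodeBool (orLang.boolIndicator x)
  rw [boolIndicator_orLang]
  rfl

/-- The OR machine has bounded hardware (3 stacks, Boolean alphabets, 6 memory values).
[folklore] -/
theorem hasBoundedHardware : machine.HasBoundedHardware := by
  refine ⟨?_, fun k => ⟨?_, ?_⟩, ?_⟩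
  · show Nat.card K3 ≤ 8
    rw [Nat.card_eq_fintype_card]
    decide
  · show Finite Bool
    infer_instance
  · show Nat.card Bool ≤ 4
    simp
  · show Nat.card (Bool × Option Bool) ≤ 8
    rw [Nat.card_eq_fintype_card]
    decide

/-- Its program has seven nodes. [folklore] -/
theorem progNodes_eq : machine.progNodes = 7 := by
  show (∑ q : Unit, stmtNodes (prog q)) = 7
  simp [prog, stmtNodes]

/-- Its rendered description length is `7` (one label). [folklore] -/
theorem descLen_eq : machine.descLen = 7 := by
  unfold SpaceMachine.descLen
  rw [progNodes_eq]
  show 7 * (Nat.log 2 (Nat.card Unit) + 1) = 7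
  simp

end OrAnswer

/-- **`orLang ∈ SpaceClass 1`** (hence `∈ LOGSPACE`). [folklore] -/
theorem orLang_mem_spaceClass_one : orLang ∈ SpaceClass fun _ => 1 :=
  ⟨OrAnswer.machine, OrAnswer.decidesInSpace⟩

/-- `orLang ∈ LOGSPACE`. [cite: AroraBarak2009, Def. 4.5] -/
theorem orLang_mem_LOGSPACE : orLang ∈ LOGSPACE :=
  spaceClass_one_subset_LOGSPACE orLang_mem_spaceClass_one

/-- **The `n`-bit OR lies in the rendered `DSPACE(t)/ₙ a` for all `t ≥ 1`, `a ≥ 7`** (every `n`).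
[cite: Hirahara2023NonDisjoint, Def. 4.7 (p. 33), rendering D13] -/
theorem orLang_slice_mem_DSPACEdl {t a : ℕ} (ht : 1 ≤ t) (ha : 7 ≤ a) (n : ℕ) :
    (fun v : Fin n → Bool => orLang.boolIndicator (List.ofFn v)) ∈ DSPACEdl t a n :=
  mem_DSPACEdl_of_decidesInSpace OrAnswer.hasBoundedHardware OrAnswer.decidesInSpace
    (fun _ _ => ht) (OrAnswer.descLen_eq.le.trans ha)

/-- The same, with the slice written as the `n`-bit OR. [folklore] -/
theorem or_mem_DSPACEdl {t a : ℕ} (ht : 1 ≤ t) (ha : 7 ≤ a) (n : ℕ) :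
    (fun v : Fin n → Bool => decide (∃ i, v i = true)) ∈ DSPACEdl t a n := by
  have h := orLang_slice_mem_DSPACEdl ht ha n
  simp only [boolIndicator_orLang_ofFn] at h
  exact h

end Literature.Computability.Complexity

end
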